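/-
Copyright (c) 2026. All rights reserved.
Released under Apache 2.0 license as described in the file LICENSE.
-/
import Literature.NumberTheory.Automorphic.BrandtModuleRamifiedSignSpaceDimension
import HarnessLib

/-!
# The Hecke operators on the functions on `Cl_T(O)`: the Brandt matrices descend along `Cls O → Cl_T(O)`
# (Martin 2018, §3.3 (3.8): `M_0^{+_𝔐}(O) ≃ {φ : Cl_𝔐(O) → ℂ}` as Hecke modules)

[tag: quaternion_algebra] [tag: eichler_order] [tag: hecke_operator]

Topic `NumberTheory/Automorphic`. Lane `lit-hodgefound`, seat p12, gen 52 — sequel of `QuaternionicSIdealClasses.lean`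
(`M^{+_T}(O)` = the pull-backs of the functions on `Cl_T(O)`, a Hecke submodule of `ℚ^{Cls O}`).

[Martin2018, §3.3]: "The description of the Jacquet–Langlands correspondence above tells us we have Hecke module
isomorphisms … we can view forms in `M_k^{+_𝔐}(O)` as certain functions on `Cl_S(O)`. In particular, for weight zero we
see that `M_0^{+_𝔐}(O) ≃ {φ : Cl_𝔐(O) → ℂ}` (3.8)." The Hecke structure transported to the functions on `Cl_T(O)` is made
explicit here: for a Brandt setup `S` (an Eichler order `O` of level `N⁺` in the definite quaternion algebra of
discriminant `N⁻` over `ℚ`), a finite `T` and `n ∈ ℕ`, the `T`-CLASS BRANDT MATRIX (DEFINITION `XiSetup.sClassMatrix`)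

  `B_T(n)_{X,Y} = ∑_{c' ∈ Y} T(n)_{c,c'}`  (`c` any class in `X`; independent of the choice, §1)

satisfies

* §1 **`sClassMatrix_eq_sum`** (independence of the representative: `T(n)_{Φ c, c'} = T(n)_{c, Φ c'}` and `Φ` permutes `Y`),
  `sClassMatrix_nonneg`;
* §2 ★ **`mulVec_comp_sClassOf`** / **`map_mulVec_comp_sClassOf`** (`T(n)(g ∘ π) = (B_T(n) g) ∘ π` for `π : Cls O → Cl_T(O)`:
  the pull-back `g ↦ g ∘ π`, an isomorphism onto `M^{+_T}(O)`, intertwines `B_T(n)` and `T(n)`), `sum_sClassMatrix_eq`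
  (row sums of `B_T(n)` = row sums of `T(n)`);
* §3 the algebra: `sClassMatrix_one` (`B_T(1) = 1`), **`sClassMatrix_mul_of_coprime`** (`B_T(mn) = B_T(m) B_T(n)`,
  `gcd(m,n) = 1`), `sClassMatrix_comm_of_coprime`, `sClassOf_atkinLehnerHom_of_subset`, ★ **`sClassMatrix_divisorOf_eq_one`** (`B_T(d_g) = 1` for `g` supported on
  the ramified primes in `T`: the ramified Hecke operators `T_𝔭`, `𝔭 ∈ S`, act trivially on `M^{+_S}(O)` — Martin's
  "`T_𝔭 φ = χ_𝔭 φ`" with `χ = +`), `sClassMatrix_ramified_eq_one` (`B_T(q) = 1`, `q ∈ T` ramified);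
* §4 eigenvectors: **`mulVec_eq_smul_iff_comp_sClassOf`** (`B_T(n) g = λ g ⟺ T(n)(g ∘ π) = λ (g ∘ π)`: the eigenforms in
  `M^{+_T}(O)` are the pulled-back eigenvectors of the `B_T(n)`), `comp_sClassOf_mem_signSpace_one_and_eigen`.

## References

* [Martin2018] K. Martin, *Congruences for modular forms mod 2 and quaternionic `S`-ideal classes*, Canad. J. Math. 70
  (2018) (held: arXiv 1701.07864): §3.1 (Hecke operators on `M_k(O)`, Brandt matrices), §3.3 (3.7)–(3.8).
* [VignerasLNM800] M.-F. Vignéras, *Arithmétique des algèbres de quaternions*, LNM 800 (1980), Ch. III §5 exercice 5.8.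
* [Voight2021] J. Voight, *Quaternion Algebras*, GTM 288 (2021): 41.2 (Brandt matrices), Cor. 41.4.10.

## Scope (honest)

Weight `0`, `F = ℚ`, Eichler level with the level involutions admitted. The matrix `B_T(n)` is defined through a chosen
representative of each `T`-class and proved independent of it. One definition, theorems otherwise; no named fact, no
instance.
-/

noncomputable section

open scoped Pointwise Matrix

namespace Literature.NumberTheory.Automorphic

namespace Brandt

variable {Nplus Nminus : ℕ} (S : XiSetup Nplus Nminus) (T : Finset ℕ)

/-! ## §1 The `T`-class Brandt matrices -/

open Classical in
/-- **The `T`-class Brandt matrix `B_T(n)_{X,Y} = ∑_{c' ∈ Y} T(n)_{c,c'}`** (`c` the chosen representative of `X`): the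
Hecke operator `T(n)` of the Brandt module pushed down to the functions on Martin's `Cl_T(O)` along `Cls O → Cl_T(O)`.
[cite: Martin2018, §3.1 and §3.3 (3.8)] [cite: Voight2021, 41.2] -/
def XiSetup.sClassMatrix (T : Finset ℕ) [Fintype (ClassSet S.O)] (n : ℕ) : Matrix (S.SClassSet T) (S.SClassSet T) ℤ :=
  fun X Y => ∑ c' ∈ Finset.univ.filter (fun c' : ClassSet S.O => S.sClassOf T c' = Y),
    matrix S.O n (S.sClassOf_surjective T X).choose c'

variable [Fintype (ClassSet S.O)]

open Classical in
/-- Unfolding `B_T(n)` at the chosen representative. [cite: Martin2018, §3.3 (3.8)] -/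
theorem XiSetup.sClassMatrix_apply (n : ℕ) (X Y : S.SClassSet T) :
    S.sClassMatrix T n X Y = ∑ c' ∈ Finset.univ.filter (fun c' : ClassSet S.O => S.sClassOf T c' = Y),
      matrix S.O n (S.sClassOf_surjective T X).choose c' :=
  rfl

open Classical in
/-- The block sum `∑_{c' ∈ Y} T(n)_{c,c'}` does not change when `c` is moved inside its `T`-class by `Φ_T(g)`
(`T(n)_{Φ c, c'} = T(n)_{c, Φ c'}` and `Φ` permutes `Y`). [cite: Voight2021, (41.3.5)] [cite: VignerasLNM800, Ch. III §5 exercice 5.8 (d)] -/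
theorem XiSetup.sum_filter_matrix_atkinLehnerHom (n : ℕ) (g : T → Multiplicative (ZMod 2)) (c : ClassSet S.O)
    (Y : S.SClassSet T) :
    ∑ c' ∈ Finset.univ.filter (fun c' : ClassSet S.O => S.sClassOf T c' = Y), matrix S.O n (S.atkinLehnerHom T g c) c' =
      ∑ c' ∈ Finset.univ.filter (fun c' : ClassSet S.O => S.sClassOf T c' = Y), matrix S.O n c c' := by
  rw [Finset.sum_filter, Finset.sum_filter]
  -- reindex the right-hand side by the involution `Φ_T(g)`
  have hperm := Fintype.sum_equiv (S.atkinLehnerHom T g)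
    (fun c' => if S.sClassOf T (S.atkinLehnerHom T g c') = Y then matrix S.O n c (S.atkinLehnerHom T g c') else 0)
    (fun c' => if S.sClassOf T c' = Y then matrix S.O n c c' else 0) (fun _ => rfl)
  rw [← hperm]
  refine Finset.sum_congr rfl fun c' _ => ?_
  rw [S.sClassOf_atkinLehnerHom]
  split_ifs
  · -- `T(n)_{Φ c, c'} = T(n)_{Φ c, Φ (Φ c')} = T(n)_{c, Φ c'}`
    conv_lhs => rw [← S.atkinLehnerHom_atkinLehnerHom T g c']
    exact S.matrix_apply_atkinLehnerHom_atkinLehnerHom T g n c (S.atkinLehnerHom T g c')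
  · rfl

open Classical in
/-- **`B_T(n)_{X,Y} = ∑_{c' ∈ Y} T(n)_{c,c'}` for EVERY `c ∈ X`** (independence of the representative).
[cite: Martin2018, §3.3 (3.8)] [cite: Voight2021, (41.3.5)] -/
theorem XiSetup.sClassMatrix_eq_sum (n : ℕ) {c : ClassSet S.O} {X : S.SClassSet T} (hc : S.sClassOf T c = X)
    (Y : S.SClassSet T) :
    S.sClassMatrix T n X Y = ∑ c' ∈ Finset.univ.filter (fun c' : ClassSet S.O => S.sClassOf T c' = Y), matrix S.O n c c' := by
  rw [S.sClassMatrix_apply]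
  have hρ : S.sClassOf T (S.sClassOf_surjective T X).choose = X := (S.sClassOf_surjective T X).choose_spec
  -- the chosen representative is `Φ_T(g) c` for some `g`
  obtain ⟨g, hg⟩ := (S.sClassOf_eq_sClassOf_iff_exists_atkinLehnerHom T c _).mp (hc.trans hρ.symm)
  rw [← hg]
  exact S.sum_filter_matrix_atkinLehnerHom T n g c Y

/-- `B_T(n)` has nonnegative entries. [cite: Voight2021, 41.2] -/
theorem XiSetup.sClassMatrix_nonneg (n : ℕ) (X Y : S.SClassSet T) : 0 ≤ S.sClassMatrix T n X Y := by
  classical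
  rw [S.sClassMatrix_apply]
  exact Finset.sum_nonneg fun c' _ => by
    rw [matrix, Matrix.of_apply]
    exact Nat.cast_nonneg _

/-! ## §2 `T(n) (g ∘ π) = (B_T(n) g) ∘ π` -/

/-- **`T(n)(g ∘ π) = (B_T(n) g) ∘ π`** for `π : Cls O → Cl_T(O)` and every `g : Cl_T(O) → ℤ`: the Brandt matrices act on
the pulled-back `T`-class functions through the `T`-class Brandt matrices. [cite: Martin2018, §3.3 (3.8)] [cite: Voight2021, Cor. 41.4.10] -/
theorem XiSetup.mulVec_comp_sClassOf [Fintype (S.SClassSet T)] (n : ℕ) (g : S.SClassSet T → ℤ) :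
    matrix S.O n *ᵥ (g ∘ S.sClassOf T) = (S.sClassMatrix T n *ᵥ g) ∘ S.sClassOf T := by
  classical
  funext c
  rw [Function.comp_apply, Matrix.mulVec, Matrix.mulVec, dotProduct, dotProduct]
  -- group the classes `c'` by their `T`-class
  rw [← Finset.sum_fiberwise Finset.univ (S.sClassOf T) fun c' => matrix S.O n c c' * (g ∘ S.sClassOf T) c']
  refine Finset.sum_congr rfl fun Y _ => ?_
  rw [S.sClassMatrix_eq_sum T n rfl Y, Finset.sum_mul]
  refine Finset.sum_congr rfl fun c' hc' => ?_
  rw [Function.comp_apply, (Finset.mem_filter.mp hc').2]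

/-- The same over `ℚ`. [cite: Martin2018, §3.3 (3.8)] -/
theorem XiSetup.map_mulVec_comp_sClassOf [Fintype (S.SClassSet T)] (n : ℕ) (g : S.SClassSet T → ℚ) :
    (matrix S.O n).map (Int.cast : ℤ → ℚ) *ᵥ (g ∘ S.sClassOf T) =
      ((S.sClassMatrix T n).map (Int.cast : ℤ → ℚ) *ᵥ g) ∘ S.sClassOf T := by
  classical
  funext c
  rw [Function.comp_apply, Matrix.mulVec, Matrix.mulVec, dotProduct, dotProduct]
  rw [← Finset.sum_fiberwise Finset.univ (S.sClassOf T)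
    fun c' => (matrix S.O n).map (Int.cast : ℤ → ℚ) c c' * (g ∘ S.sClassOf T) c']
  refine Finset.sum_congr rfl fun Y _ => ?_
  rw [Matrix.map_apply, S.sClassMatrix_eq_sum T n rfl Y, Int.cast_sum, Finset.sum_mul]
  refine Finset.sum_congr rfl fun c' hc' => ?_
  rw [Matrix.map_apply, Function.comp_apply, (Finset.mem_filter.mp hc').2]

/-- **Row sums: `∑_Y B_T(n)_{X,Y} = ∑_{c'} T(n)_{c,c'}`** (`c ∈ X`; the degree of `T(n)`). [cite: Voight2021, 41.2] -/
theorem XiSetup.sum_sClassMatrix_eq [Fintype (S.SClassSet T)] (n : ℕ) {c : ClassSet S.O} {X : S.SClassSet T}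
    (hc : S.sClassOf T c = X) : ∑ Y, S.sClassMatrix T n X Y = ∑ c', matrix S.O n c c' := by
  classical
  rw [← Finset.sum_fiberwise Finset.univ (S.sClassOf T) fun c' => matrix S.O n c c']
  exact Finset.sum_congr rfl fun Y _ => S.sClassMatrix_eq_sum T n hc Y

/-! ## §3 The algebra of the `B_T(n)` -/

omit [Fintype (ClassSet S.O)] in
/-- Two matrices on `Cl_T(O)` agree if they act identically on the pulled-back functions. [folklore] -/
private theorem sClassMatrix_ext [Fintype (S.SClassSet T)] {B C : Matrix (S.SClassSet T) (S.SClassSet T) ℤ}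
    (h : ∀ g : S.SClassSet T → ℤ, (B *ᵥ g) ∘ S.sClassOf T = (C *ᵥ g) ∘ S.sClassOf T) : B = C := by
  refine Matrix.ext_iff_mulVec.mpr fun g => ?_
  funext X
  obtain ⟨c, rfl⟩ := S.sClassOf_surjective T X
  exact congrFun (h g) c

/-- **`B_T(1) = 1`.** [cite: Voight2021, 41.2] -/
theorem XiSetup.sClassMatrix_one [Fintype (S.SClassSet T)] [DecidableEq (S.SClassSet T)] [DecidableEq (ClassSet S.O)] :
    S.sClassMatrix T 1 = 1 := by
  refine sClassMatrix_ext S T fun g => ?_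
  rw [← S.mulVec_comp_sClassOf T 1 g, Brandt.matrix_one S.O, Matrix.one_mulVec, Matrix.one_mulVec]

/-- **`B_T(mn) = B_T(m) B_T(n)` for coprime `m, n`** (from `T(mn) = T(m) T(n)` and the intertwining).
[cite: VignerasLNM800, Ch. III §5 exercice 5.8 (c)] [cite: Martin2018, §3.1] -/
theorem XiSetup.sClassMatrix_mul_of_coprime [Fintype (S.SClassSet T)] {m n : ℕ} (hmn : Nat.Coprime m n) :
    S.sClassMatrix T (m * n) = S.sClassMatrix T m * S.sClassMatrix T n := by
  refine sClassMatrix_ext S T fun g => ?_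
  rw [← S.mulVec_comp_sClassOf T (m * n) g, S.matrix_mul_of_coprime hmn, ← Matrix.mulVec_mulVec,
    ← Matrix.mulVec_mulVec, S.mulVec_comp_sClassOf T n g, S.mulVec_comp_sClassOf T m]

/-- `B_T(m) B_T(n) = B_T(n) B_T(m)` for coprime `m, n`. [cite: VignerasLNM800, Ch. III §5 exercice 5.8 (c)–(d)] -/
theorem XiSetup.sClassMatrix_comm_of_coprime [Fintype (S.SClassSet T)] {m n : ℕ} (hmn : Nat.Coprime m n) :
    S.sClassMatrix T m * S.sClassMatrix T n = S.sClassMatrix T n * S.sClassMatrix T m := by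
  rw [← S.sClassMatrix_mul_of_coprime T hmn, mul_comm, S.sClassMatrix_mul_of_coprime T hmn.symm]

omit [Fintype (ClassSet S.O)] in
/-- `Φ_{T'}(g)` does not change the `T`-class when `T' ⊆ T`. [cite: Martin2018, §4.4] -/
theorem XiSetup.sClassOf_atkinLehnerHom_of_subset {T' : Finset ℕ} (hT'T : T' ⊆ T) (g : T' → Multiplicative (ZMod 2))
    (c : ClassSet S.O) : S.sClassOf T (S.atkinLehnerHom T' g c) = S.sClassOf T c :=
  (S.sClassOf_eq_sClassOf_iff T _ _).mpr
    (S.sClassSetoid_mono hT'T ((S.sClassOf_eq_sClassOf_iff T' _ _).mp (S.sClassOf_atkinLehnerHom T' g c)))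

/-- **`B_T(d_g) = 1` when `T' ⊆ T` consists of ramified primes and `g ∈ (ℤ/2ℤ)^{T'}`**: the Brandt matrices at the
divisors of `N⁻` supported in `T` act trivially on the `T`-class functions (Martin: `T_𝔭 φ = +φ` on `M^{+_𝔐}(O)` for
`𝔭 ∣ 𝔐`). [cite: Martin2018, §3.3 (`M_k^χ(O)`, `T_𝔭 φ = χ_𝔭 φ`) and §4.1] -/
theorem XiSetup.sClassMatrix_divisorOf_eq_one [DecidableEq (S.SClassSet T)] {T' : Finset ℕ}
    (hT' : T' ⊆ Nminus.primeFactors) (hT'T : T' ⊆ T) (g : T' → Multiplicative (ZMod 2)) :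
    S.sClassMatrix T (divisorOf T' g) = 1 := by
  classical
  ext X Y
  obtain ⟨c, rfl⟩ := S.sClassOf_surjective T X
  rw [S.sClassMatrix_eq_sum T _ rfl Y, Matrix.one_apply]
  simp_rw [S.matrix_divisorOf_apply hT' g]
  have hiff : ∀ c' : ClassSet S.O, (c = S.atkinLehnerHom T' g c') ↔ (S.atkinLehnerHom T' g c = c') := fun c' =>
    ⟨fun h => by rw [h, S.atkinLehnerHom_atkinLehnerHom], fun h => by rw [← h, S.atkinLehnerHom_atkinLehnerHom]⟩
  simp_rw [hiff]
  rw [Finset.sum_ite_eq]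
  simp only [Finset.mem_filter, Finset.mem_univ, true_and, S.sClassOf_atkinLehnerHom_of_subset T hT'T g c]

/-- **`B_T(q) = 1` for a ramified prime `q ∈ T`** (`T(q)` is the permutation matrix of `W_{q⁻}`, which fixes every
`T`-class). [cite: Martin2018, §3.3 and §4.1] [cite: VignerasLNM800, Ch. III §5 exercice 5.8 (b)] -/
theorem XiSetup.sClassMatrix_ramified_eq_one [DecidableEq (S.SClassSet T)] {q : ℕ} [Fact q.Prime] (hq : q ∣ Nminus)
    (hqT : q ∈ T) : S.sClassMatrix T q = 1 := by
  classical
  ext X Y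
  obtain ⟨c, rfl⟩ := S.sClassOf_surjective T X
  rw [S.sClassMatrix_eq_sum T _ rfl Y, Matrix.one_apply]
  simp_rw [S.matrix_ramified_apply_of_dvd hq]
  have hiff : ∀ c' : ClassSet S.O, (c = S.wMinus q hq c') ↔ (S.wMinus q hq c = c') := fun c' =>
    ⟨fun h => by rw [h, S.wMinus_wMinus], fun h => by rw [← h, S.wMinus_wMinus]⟩
  simp_rw [hiff]
  rw [Finset.sum_ite_eq]
  have hclass : S.sClassOf T (S.wMinus q hq c) = S.sClassOf T c := by
    rw [← S.atkinLehner_of_dvd hq]; exact S.sClassOf_atkinLehner_of_mem T hqT c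
  simp only [Finset.mem_filter, Finset.mem_univ, true_and, hclass]

/-! ## §4 Eigenvectors -/

/-- **`B_T(n) g = μ g ⟺ T(n)(g ∘ π) = μ (g ∘ π)`**: the eigenvectors of the Brandt matrices inside `M^{+_T}(O)` are exactly
the pull-backs of the eigenvectors of the `T`-class Brandt matrices. [cite: Martin2018, §3.3 (3.7)–(3.8)] -/
theorem XiSetup.mulVec_eq_smul_iff_comp_sClassOf [Fintype (S.SClassSet T)] (n : ℕ) (g : S.SClassSet T → ℚ) (μ : ℚ) :
    (S.sClassMatrix T n).map (Int.cast : ℤ → ℚ) *ᵥ g = μ • g ↔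
      (matrix S.O n).map (Int.cast : ℤ → ℚ) *ᵥ (g ∘ S.sClassOf T) = μ • (g ∘ S.sClassOf T) := by
  rw [S.map_mulVec_comp_sClassOf]
  constructor
  · intro h; rw [h]; rfl
  · intro h
    funext X
    obtain ⟨c, rfl⟩ := S.sClassOf_surjective T X
    have := congrFun h c
    rw [Function.comp_apply, Pi.smul_apply, Function.comp_apply] at this
    rw [Pi.smul_apply]
    exact this

/-- A simultaneous eigenvector `g` of the `B_T(n)` pulls back to a form `g ∘ π ∈ M^{+_T}(O)` which is a simultaneous
eigenvector of the `T(n)` with the same eigenvalues. [cite: Martin2018, §3.3 (3.7)–(3.8)] -/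
theorem XiSetup.comp_sClassOf_mem_signSpace_one_and_eigen [Fintype (S.SClassSet T)] {g : S.SClassSet T → ℚ} {μ : ℕ → ℚ}
    (h : ∀ n, (S.sClassMatrix T n).map (Int.cast : ℤ → ℚ) *ᵥ g = μ n • g) :
    g ∘ S.sClassOf T ∈ S.signSpace T 1 ∧
      ∀ n, (matrix S.O n).map (Int.cast : ℤ → ℚ) *ᵥ (g ∘ S.sClassOf T) = μ n • (g ∘ S.sClassOf T) :=
  ⟨(S.mem_signSpace_one_iff_exists_comp_sClassOf T _).mpr ⟨g, rfl⟩,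
    fun n => (S.mulVec_eq_smul_iff_comp_sClassOf T n g (μ n)).mp (h n)⟩

end Brandt

end Literature.NumberTheory.Automorphic
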